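import Mathlib
import Literature.Geometry.Symplectic.JHolomorphicRegularityHolderAux
import Literature.Geometry.Symplectic.JHolomorphicRegularityHolderLoc
import HarnessLib

/-!
# Elliptic bootstrapping for `J`-holomorphic curves in Hölder classes: cutting off

Two constructions with smooth cutoffs for the local Hölder classes
`∃ W, MemContDiffHolder k r W ∧ W =ᶠ[𝓝 z₀] g` of
`Literature/Geometry/Symplectic/JHolomorphicRegularityHolderLoc.lean`, used in the Hölder
bootstrapping of `J`-holomorphic curves (McDuff–Salamon 2012, Thm. B.4.1):

* `locHolder_one_of_bounds` — a map which on a disc `B(z₀, ρ)` is differentiable with bounded,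
  `r`-Hölder derivative is of local class `C^{1,r}` near `z₀` (`χ • g` for a cutoff `χ`);
* `locHolder_succ_of_fderiv` — a map of local class `C^{k,r}` whose two partial derivatives
  `Dg(·) 1`, `Dg(·) i` are of local class `C^{k,r}` is of local class `C^{k+1,r}`;
* `locHolder_one_of_holder_fderiv` — a `C¹` map with locally `r`-Hölder derivative is of local
  class `C^{1,r}` near every point.

## References

* D. McDuff, D. Salamon, *J-holomorphic curves and symplectic topology*, 2nd ed. (2012),
  App. B.4, Thm. B.4.1. [McDuffSalamon2012]
* D. Gilbarg, N. S. Trudinger, *Elliptic Partial Differential Equations of Second Order* (2001),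
  §4.1, §6.2. [GilbargTrudinger2001]
-/

noncomputable section

open Set Metric Filter Function
open scoped Topology NNReal ContDiff

namespace Literature.Geometry.Symplectic

open Literature.Analysis.FunctionSpaces

section General

variable {Y : Type*} [NormedAddCommGroup Y] [NormedSpace ℝ Y]

omit [NormedSpace ℝ Y] in
/-- `HolderOnWith` from a real Hölder-type bound on a set. [folklore] -/
theorem holderOnWith_of_norm_sub_le {f : ℂ → Y} {s : Set ℂ} {K : ℝ} {r : ℝ≥0} (hK : 0 ≤ K)
    (h : ∀ x ∈ s, ∀ y ∈ s, ‖f x - f y‖ ≤ K * ‖x - y‖ ^ (r : ℝ)) :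
    HolderOnWith K.toNNReal r f s := by
  intro x hx y hy
  rw [edist_dist, edist_dist, ENNReal.ofReal_rpow_of_nonneg dist_nonneg r.coe_nonneg,
    ← ENNReal.ofReal_coe_nnreal, ← ENNReal.ofReal_mul (K.toNNReal).coe_nonneg,
    Real.coe_toNNReal K hK, dist_eq_norm, dist_eq_norm]
  exact ENNReal.ofReal_le_ofReal (h x hx y hy)

/-- **`χ • g` is globally `C^n`** when the smooth cutoff `χ` has support inside an open set on
which `g` is `C^n` (off that set the product vanishes near every point). [folklore] -/
theorem contDiff_smul_of_contDiffOn {χ : ℂ → ℝ} (hχ : ContDiff ℝ ∞ χ) {g : ℂ → Y} {U : Set ℂ}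
    {n : ℕ} (hU : IsOpen U) (hg : ContDiffOn ℝ n g U) (hχU : tsupport χ ⊆ U) :
    ContDiff ℝ n fun z => χ z • g z := by
  rw [contDiff_iff_contDiffAt]
  intro z
  by_cases hz : z ∈ U
  · exact (hχ.of_le (by exact_mod_cast le_top)).contDiffAt.smul (hg.contDiffAt (hU.mem_nhds hz))
  · have hz' : z ∉ tsupport χ := fun h => hz (hχU h)
    have hev : (fun z => χ z • g z) =ᶠ[𝓝 z] fun _ => (0 : Y) := by
      filter_upwards [notMem_tsupport_iff_eventuallyEq.1 hz'] with w hw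
      simp [hw]
    exact (contDiffAt_const (c := (0 : Y))).congr_of_eventuallyEq hev

/-- **The derivative of `χ • g` at every point**, when `g` is differentiable on an open set
containing the support of the smooth cutoff `χ`: `D(χ g)(z) = χ z • Dg(z) + Dχ(z) ⊗ g z` (both
sides vanish off the support). [folklore] -/
theorem hasFDerivAt_cutoff_smul {χ : ℂ → ℝ} (hχ : ContDiff ℝ ∞ χ) {g : ℂ → Y} {U : Set ℂ}
    (hg : ∀ z ∈ U, DifferentiableAt ℝ g z) (hχU : tsupport χ ⊆ U) (z : ℂ) :
    HasFDerivAt (fun z => χ z • g z) (χ z • fderiv ℝ g z + (fderiv ℝ χ z).smulRight (g z)) z := by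
  by_cases hz : z ∈ U
  · exact ((hχ.differentiable (by simp)) z).hasFDerivAt.smul (hg z hz).hasFDerivAt
  · have hz' : z ∉ tsupport χ := fun h => hz (hχU h)
    have hχ0 : χ =ᶠ[𝓝 z] fun _ => 0 := notMem_tsupport_iff_eventuallyEq.1 hz'
    have h1 : χ z = 0 := hχ0.self_of_nhds
    have h2 : fderiv ℝ χ z = 0 := by rw [hχ0.fderiv_eq, fderiv_const_apply]
    have hev : (fun z => χ z • g z) =ᶠ[𝓝 z] fun _ => (0 : Y) := by
      filter_upwards [hχ0] with w hw
      simp [hw]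
    have h3 : χ z • fderiv ℝ g z + (fderiv ℝ χ z).smulRight (g z) = 0 := by
      rw [h1, h2, zero_smul, zero_add]
      ext1
      simp
    rw [h3]
    exact (hasFDerivAt_const (0 : Y) z).congr_of_eventuallyEq hev

/-- Bounds for the first two derivatives of a smooth compactly supported cutoff (both `χ` and
`Dχ` are Lipschitz, being smooth with compact support). [folklore] -/
theorem exists_cutoff_fderiv_bounds {χ : ℂ → ℝ} (hχ : ContDiff ℝ ∞ χ) (hχc : HasCompactSupport χ) :
    ∃ c : ℝ, 0 ≤ c ∧ (∀ z, ‖fderiv ℝ χ z‖ ≤ c) ∧ ∀ z, ‖fderiv ℝ (fderiv ℝ χ) z‖ ≤ c := by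
  have hD : ContDiff ℝ ∞ (fderiv ℝ χ) := (contDiff_infty_iff_fderiv.1 hχ).2
  obtain ⟨C₁, hC₁⟩ := hχ.lipschitzWith_of_hasCompactSupport hχc (by simp)
  obtain ⟨C₂, hC₂⟩ := hD.lipschitzWith_of_hasCompactSupport (hχc.fderiv (𝕜 := ℝ)) (by simp)
  refine ⟨max C₁ C₂, by positivity, fun z => ?_, fun z => ?_⟩
  · exact (norm_fderiv_le_of_lipschitz ℝ hC₁).trans (by exact_mod_cast le_max_left _ _)
  · exact (norm_fderiv_le_of_lipschitz ℝ hC₂).trans (by exact_mod_cast le_max_right _ _)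

/-- Sup and Hölder bounds for a smooth compactly supported cutoff and its derivative:
`‖χ‖ ≤ c`, `[χ]_s ≤ c`, `‖Dχ‖ ≤ c`, `[Dχ]_s ≤ c` for one constant `c` (`0 ≤ s ≤ 1`). [folklore] -/
theorem exists_cutoff_holder_bounds {χ : ℂ → ℝ} (hχ : ContDiff ℝ ∞ χ) (hχc : HasCompactSupport χ)
    {s : ℝ} (hs0 : 0 ≤ s) (hs1 : s ≤ 1) :
    ∃ c : ℝ, 0 ≤ c ∧ (∀ z, ‖χ z‖ ≤ c) ∧ (∀ z z', ‖χ z - χ z'‖ ≤ c * ‖z - z'‖ ^ s) ∧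
      (∀ z, ‖fderiv ℝ χ z‖ ≤ c) ∧
      ∀ z z', ‖fderiv ℝ χ z - fderiv ℝ χ z'‖ ≤ c * ‖z - z'‖ ^ s := by
  obtain ⟨c, hc, hc₁, hc₂⟩ := exists_cutoff_fderiv_bounds hχ hχc
  obtain ⟨c₀, hc₀⟩ := hχ.continuous.bounded_above_of_compact_support hχc
  have hc₀' : 0 ≤ c₀ := (norm_nonneg _).trans (hc₀ 0)
  have hd : Differentiable ℝ χ := hχ.differentiable (by simp)
  have hdD : Differentiable ℝ (fderiv ℝ χ) :=
    (contDiff_infty_iff_fderiv.1 hχ).2.differentiable (by simp)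
  have hH := holder_of_norm_fderiv_le hd hs0 hs1 hc₀ hc₁
  have hH' := holder_of_norm_fderiv_le hdD hs0 hs1 hc₁ hc₂
  have hd0 : ∀ z z' : ℂ, 0 ≤ ‖z - z'‖ ^ s := fun z z' => Real.rpow_nonneg (norm_nonneg _) _
  exact ⟨2 * c₀ + 3 * c, by positivity, fun z => (hc₀ z).trans (by linarith),
    fun z z' => (hH z z').trans (mul_le_mul_of_nonneg_right (by linarith) (hd0 z z')),
    fun z => (hc₁ z).trans (by linarith),
    fun z z' => (hH' z z').trans (mul_le_mul_of_nonneg_right (by linarith) (hd0 z z'))⟩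

end General

section LocOne

variable {Y : Type*} [NormedAddCommGroup Y] [NormedSpace ℝ Y] {r : ℝ≥0}

/-- **Local `C^{1,r}` class from bounds on a disc.** If `g` is differentiable on `B(z₀, ρ)` with
`‖g‖ ≤ b`, `‖Dg‖ ≤ b` and `‖Dg z - Dg z'‖ ≤ b ‖z - z'‖ ^ r` there (`0 < r ≤ 1`), then `g` agrees
near `z₀` with a member of `C^{1,r}_b(ℂ, Y)`, namely `χ • g` for a smooth cutoff `χ` supported in
`B(z₀, ρ/2)` and equal to `1` near `z₀`. [folklore] -/
theorem locHolder_one_of_bounds {g : ℂ → Y} {z₀ : ℂ} {ρ b : ℝ} (hρ : 0 < ρ) (hr0 : 0 < r)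
    (hr1 : r ≤ 1) (hg : ∀ z ∈ ball z₀ ρ, DifferentiableAt ℝ g z)
    (hb₀ : ∀ z ∈ ball z₀ ρ, ‖g z‖ ≤ b) (hb₁ : ∀ z ∈ ball z₀ ρ, ‖fderiv ℝ g z‖ ≤ b)
    (hb₂ : ∀ z ∈ ball z₀ ρ, ∀ z' ∈ ball z₀ ρ,
      ‖fderiv ℝ g z - fderiv ℝ g z'‖ ≤ b * ‖z - z'‖ ^ (r : ℝ)) :
    ∃ W : ℂ → Y, MemContDiffHolder 1 r W ∧ W =ᶠ[𝓝 z₀] g := by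
  have hr0' : 0 < (r : ℝ) := hr0
  have hr1' : (r : ℝ) ≤ 1 := hr1
  have hb : 0 ≤ b := (norm_nonneg _).trans (hb₀ z₀ (mem_ball_self hρ))
  -- the cutoff
  have hKU : closedBall z₀ (ρ / 4) ⊆ ball z₀ (ρ / 2) := closedBall_subset_ball (by linarith)
  obtain ⟨χ, hχ, hχc, hχU, hχ1, hχ01⟩ :=
    exists_contDiff_one_nhdsSet_of_isCompact (isCompact_closedBall z₀ (ρ / 4)) isOpen_ball hKU
  have hχU' : tsupport χ ⊆ ball z₀ ρ := hχU.trans (ball_subset_ball (by linarith))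
  have hχs : ∀ z, χ z ≠ 0 → z ∈ closedBall z₀ (ρ / 2) := fun z hz =>
    ball_subset_closedBall (hχU (subset_closure (mem_support.2 hz)))
  have hχs' : ∀ z, fderiv ℝ χ z ≠ 0 → z ∈ closedBall z₀ (ρ / 2) := fun z hz =>
    ball_subset_closedBall (hχU (support_fderiv_subset ℝ (mem_support.2 hz)))
  obtain ⟨c, hc, hc₀, hc₁, hc₂, hc₃⟩ := exists_cutoff_holder_bounds hχ hχc hr0'.le hr1'
  -- the member
  set W : ℂ → Y := fun z => χ z • g z with hW
  have hWd : ∀ z, HasFDerivAt W (χ z • fderiv ℝ g z + (fderiv ℝ χ z).smulRight (g z)) z :=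
    hasFDerivAt_cutoff_smul hχ hg hχU'
  -- `g` is `C¹` on the disc, so `W` is `C¹`
  have hgH : HolderOnWith b.toNNReal r (fderiv ℝ g) (ball z₀ ρ) := holderOnWith_of_norm_sub_le hb hb₂
  have hg1 : ContDiffOn ℝ 1 g (ball z₀ ρ) := by
    rw [show (1 : WithTop ℕ∞) = 0 + 1 from rfl, contDiffOn_succ_iff_fderiv_of_isOpen isOpen_ball]
    exact ⟨fun z hz => (hg z hz).differentiableWithinAt, fun h => absurd h (by simp),
      contDiffOn_zero.2 (hgH.continuousOn hr0)⟩
  have hW1 : ContDiff ℝ 1 W := contDiff_smul_of_contDiffOn hχ isOpen_ball hg1 hχU'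
  -- the derivative as a sum of two cut-off products
  set B₁ := ContinuousLinearMap.lsmul ℝ ℝ (E := ℂ →L[ℝ] Y) with hB₁
  set B₂ := ContinuousLinearMap.smulRightL ℝ ℂ Y with hB₂
  have hfd : ∀ z, fderiv ℝ W z = B₁ (χ z) (fderiv ℝ g z) + B₂ (fderiv ℝ χ z) (g z) := by
    intro z
    rw [(hWd z).fderiv, hB₁, hB₂, ContinuousLinearMap.lsmul_apply]
    rfl
  -- bounds for the two products
  have hgHol : ∀ z ∈ ball z₀ ρ, ∀ z' ∈ ball z₀ ρ,
      ‖g z - g z'‖ ≤ b * (2 * ρ) ^ (1 - (r : ℝ)) * ‖z - z'‖ ^ (r : ℝ) := fun z hz z' hz' =>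
    holder_on_ball_of_norm_fderiv_le hg hr1' hb₁ hz hz'
  have hρ2 : ρ / 2 < ρ := by linarith
  obtain ⟨h1₀, h1₁⟩ := holder_bound_cutoff_bilinear B₁ hρ2 hr0'.le hc hc hb hb hχs hc₀ hc₁ hb₁ hb₂
  obtain ⟨h2₀, h2₁⟩ := holder_bound_cutoff_bilinear B₂ hρ2 hr0'.le hc hc hb (by positivity) hχs'
    hc₂ hc₃ hb₀ hgHol
  obtain ⟨hs₀, hs₁⟩ := holder_bound_add h1₀ h1₁ h2₀ h2₁
  -- sup bound for `W`
  obtain ⟨h0₀, -⟩ := holder_bound_cutoff_bilinear (ContinuousLinearMap.lsmul ℝ ℝ (E := Y)) hρ2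
    hr0'.le hc hc hb (by positivity) hχs hc₀ hc₁ hb₀ hgHol
  -- the Hölder bound of `DW`, with a nonnegative constant
  obtain ⟨K, hK⟩ : ∃ K : ℝ, ∀ z z', ‖fderiv ℝ W z - fderiv ℝ W z'‖ ≤ K * ‖z - z'‖ ^ (r : ℝ) :=
    ⟨_, fun z z' => by
      rw [hfd z, hfd z']
      exact hs₁ z z'⟩
  have hK0 : 0 ≤ K := by
    have h := (norm_nonneg _).trans (hK z₀ (z₀ + 1))
    simpa using h
  have hM₀ : ∀ z, ‖W z‖ ≤ ‖ContinuousLinearMap.lsmul ℝ ℝ (E := Y)‖ * c * b := fun z => by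
    simpa [hW, ContinuousLinearMap.lsmul_apply] using h0₀ z
  obtain ⟨M₁, hM₁⟩ : ∃ M₁ : ℝ, ∀ z, ‖fderiv ℝ W z‖ ≤ M₁ :=
    ⟨_, fun z => by
      rw [hfd z]
      exact hs₀ z⟩
  refine ⟨W, memContDiffHolder_one_of_bounds hW1 hM₀ hM₁ (holderWith_of_norm_sub_le hK0 hK), ?_⟩
  filter_upwards [(eventually_nhdsSet_iff_forall.1 hχ1) z₀ (mem_closedBall_self (by positivity))]
    with z hz
  simp [hW, hz]

/-- **A `C¹` map with locally `r`-Hölder derivative is of local class `C^{1,r}`** near every point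
(`0 < r ≤ 1`). [folklore] -/
theorem locHolder_one_of_holder_fderiv {u : ℂ → Y} (hr0 : 0 < r) (hr1 : r ≤ 1)
    (hu : ContDiff ℝ 1 u)
    (hH : ∀ z₀ : ℂ, ∃ C ρ : ℝ, 0 < ρ ∧ ∀ z ∈ ball z₀ ρ, ∀ z' ∈ ball z₀ ρ,
      ‖fderiv ℝ u z - fderiv ℝ u z'‖ ≤ C * ‖z - z'‖ ^ (r : ℝ)) (z₀ : ℂ) :
    ∃ W : ℂ → Y, MemContDiffHolder 1 r W ∧ W =ᶠ[𝓝 z₀] u := by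
  obtain ⟨C, ρ, hρ, hC⟩ := hH z₀
  have hud : Differentiable ℝ u := hu.differentiable (by simp)
  -- bounds for `u` and `Du` on the closed disc, by continuity
  obtain ⟨b₀, hb₀⟩ := (isCompact_closedBall z₀ ρ).exists_bound_of_continuousOn
    hu.continuous.continuousOn
  obtain ⟨b₁, hb₁⟩ := (isCompact_closedBall z₀ ρ).exists_bound_of_continuousOn
    (hu.continuous_fderiv (by simp)).continuousOn
  set b := max (max b₀ b₁) C
  refine locHolder_one_of_bounds (b := b) hρ hr0 hr1 (fun z _ => hud z)
    (fun z hz => (hb₀ z (ball_subset_closedBall hz)).trans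
      ((le_max_left _ _).trans (le_max_left _ _)))
    (fun z hz => (hb₁ z (ball_subset_closedBall hz)).trans
      ((le_max_right _ _).trans (le_max_left _ _)))
    fun z hz z' hz' => (hC z hz z' hz').trans ?_
  gcongr
  exact le_max_right _ _

end LocOne


section Assembly

variable {Y : Type} [NormedAddCommGroup Y] [NormedSpace ℝ Y] {r : ℝ≥0}

/-- A real-linear map on `ℂ` is determined by its values at `1` and `i`:
`L = re(·) • L 1 + im(·) • L i`. [folklore] -/
theorem clm_eq_smulRightL_add (L : ℂ →L[ℝ] Y) :
    L = ContinuousLinearMap.smulRightL ℝ ℂ Y Complex.reCLM (L 1) +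
      ContinuousLinearMap.smulRightL ℝ ℂ Y Complex.imCLM (L Complex.I) := by
  apply ContinuousLinearMap.ext
  intro ζ
  have hζ : ζ = (ζ.re : ℝ) • (1 : ℂ) + (ζ.im : ℝ) • Complex.I := by
    apply Complex.ext <;> simp
  conv_lhs => rw [hζ]
  simp only [map_add, map_smul, add_apply,
    ContinuousLinearMap.smulRightL_apply_apply, ContinuousLinearMap.smulRight_apply,
    Complex.reCLM_apply, Complex.imCLM_apply]

/-- **Raising the order through the partial derivatives.** If `g` is differentiable near `z₀`,
of local class `C^{k,r}` near `z₀`, and its two partial derivatives `z ↦ Dg(z) 1`,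
`z ↦ Dg(z) i` are of local class `C^{k,r}` near `z₀`, then `g` is of local class `C^{k+1,r}`
near `z₀` (`r ≤ 1`; the member is `χ • W₀` for a cutoff `χ` and the member `W₀` agreeing with
`g`, whose derivative `χ • (re ⊗ W₁ + im ⊗ W₂) + Dχ ⊗ W₀` is in `C^{k,r}_b`). [folklore] -/
theorem locHolder_succ_of_fderiv (hr : r ≤ 1) {k : ℕ} {g : ℂ → Y} {z₀ : ℂ}
    (hd : ∀ᶠ z in 𝓝 z₀, DifferentiableAt ℝ g z)
    (h0 : ∃ W, MemContDiffHolder k r W ∧ W =ᶠ[𝓝 z₀] g)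
    (h1 : ∃ W, MemContDiffHolder k r W ∧ W =ᶠ[𝓝 z₀] fun z => fderiv ℝ g z 1)
    (h2 : ∃ W, MemContDiffHolder k r W ∧ W =ᶠ[𝓝 z₀] fun z => fderiv ℝ g z Complex.I) :
    ∃ W, MemContDiffHolder (k + 1) r W ∧ W =ᶠ[𝓝 z₀] g := by
  obtain ⟨W₀, hW₀, hW₀g⟩ := h0
  obtain ⟨W₁, hW₁, hW₁g⟩ := h1
  obtain ⟨W₂, hW₂, hW₂g⟩ := h2
  -- a disc on which everything holds
  obtain ⟨ρ, hρ, hball⟩ := Metric.eventually_nhds_iff_ball.1 (hd.and (hW₀g.and (hW₁g.and hW₂g)))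
  set L₁ := ContinuousLinearMap.smulRightL ℝ ℂ Y Complex.reCLM with hL₁
  set L₂ := ContinuousLinearMap.smulRightL ℝ ℂ Y Complex.imCLM with hL₂
  -- the derivative of `g` on the disc, and smoothness of `g` and `W₀` there
  have hDg : ∀ z ∈ ball z₀ ρ, fderiv ℝ g z = L₁ (W₁ z) + L₂ (W₂ z) := fun z hz => by
    rw [(hball z hz).2.2.1, (hball z hz).2.2.2]
    exact clm_eq_smulRightL_add _
  have hsm : ContDiff ℝ k fun z => L₁ (W₁ z) + L₂ (W₂ z) :=
    (L₁.contDiff.comp hW₁.contDiff).add (L₂.contDiff.comp hW₂.contDiff)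
  have hgU : ContDiffOn ℝ ((k + 1 : ℕ) : ℕ∞) g (ball z₀ ρ) := by
    rw [show (((k + 1 : ℕ) : ℕ∞) : WithTop ℕ∞) = (k : WithTop ℕ∞) + 1 by norm_cast,
      contDiffOn_succ_iff_fderiv_of_isOpen isOpen_ball]
    refine ⟨fun z hz => (hball z hz).1.differentiableWithinAt, fun h => ?_,
      hsm.contDiffOn.congr fun z hz => hDg z hz⟩
    exact absurd h (by exact_mod_cast WithTop.coe_ne_top)
  have hW₀U : ContDiffOn ℝ ((k + 1 : ℕ) : ℕ∞) W₀ (ball z₀ ρ) := hgU.congr fun z hz => (hball z hz).2.1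
  have hW₀d : ∀ z ∈ ball z₀ ρ, DifferentiableAt ℝ W₀ z := fun z hz =>
    (hW₀U.differentiableOn (by simp)).differentiableAt (isOpen_ball.mem_nhds hz)
  have hW₀f : ∀ z ∈ ball z₀ ρ, fderiv ℝ W₀ z = L₁ (W₁ z) + L₂ (W₂ z) := fun z hz => by
    rw [← hDg z hz]
    refine Filter.EventuallyEq.fderiv_eq ?_
    filter_upwards [isOpen_ball.mem_nhds hz] with w hw
    exact (hball w hw).2.1
  -- the cutoff and the member
  have hKU : closedBall z₀ (ρ / 2) ⊆ ball z₀ ρ := closedBall_subset_ball (by linarith)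
  obtain ⟨χ, hχ, hχc, hχU, hχ1, hχ01⟩ :=
    exists_contDiff_one_nhdsSet_of_isCompact (isCompact_closedBall z₀ (ρ / 2)) isOpen_ball hKU
  have hDχ : ContDiff ℝ ∞ (fderiv ℝ χ) := (contDiff_infty_iff_fderiv.1 hχ).2
  set W : ℂ → Y := fun z => χ z • W₀ z with hW
  have hWs : ContDiff ℝ ((k + 1 : ℕ) : ℕ∞) W := contDiff_smul_of_contDiffOn hχ isOpen_ball hW₀U hχU
  have hWd : ∀ z, HasFDerivAt W (χ z • fderiv ℝ W₀ z + (fderiv ℝ χ z).smulRight (W₀ z)) z :=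
    hasFDerivAt_cutoff_smul hχ hW₀d hχU
  -- the derivative of the member, globally
  have hfdW : ∀ z, fderiv ℝ W z =
      ContinuousLinearMap.lsmul ℝ ℝ (χ z) (L₁ (W₁ z) + L₂ (W₂ z)) +
        ContinuousLinearMap.smulRightL ℝ ℂ Y (fderiv ℝ χ z) (W₀ z) := by
    intro z
    rw [(hWd z).fderiv, ContinuousLinearMap.lsmul_apply]
    by_cases hz : z ∈ ball z₀ ρ
    · rw [hW₀f z hz]
      rfl
    · have hz' : z ∉ tsupport χ := fun h => hz (hχU h)
      have hχ0 : χ =ᶠ[𝓝 z] fun _ => 0 := notMem_tsupport_iff_eventuallyEq.1 hz'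
      have e1 : χ z = 0 := hχ0.self_of_nhds
      have e2 : fderiv ℝ χ z = 0 := by rw [hχ0.fderiv_eq, fderiv_const_apply]
      simp [e1, e2]
  have hmem : MemContDiffHolder k r (fderiv ℝ W) := by
    have e : fderiv ℝ W =
        (fun z => ContinuousLinearMap.lsmul ℝ ℝ (χ z) (((fun z => L₁ (W₁ z)) + fun z => L₂ (W₂ z)) z)) +
          fun z => ContinuousLinearMap.smulRightL ℝ ℂ Y (fderiv ℝ χ z) (W₀ z) := by
      funext z
      rw [hfdW z]
      rfl
    rw [e]
    refine MemContDiffHolder.add ?_ ?_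
    · exact (MemContDiffHolder.of_contDiff_of_hasCompactSupport hχ hχc hr).bilinear hr
        (ContinuousLinearMap.lsmul ℝ ℝ) ((hW₁.clm_comp L₁).add (hW₂.clm_comp L₂))
    · exact (MemContDiffHolder.of_contDiff_of_hasCompactSupport hDχ (hχc.fderiv (𝕜 := ℝ)) hr).bilinear
        hr (ContinuousLinearMap.smulRightL ℝ ℂ Y) hW₀
  -- boundedness and conclusion
  obtain ⟨a₀, ha₀⟩ := hW₀.exists_norm_le
  have hbd : ∀ z, ‖W z‖ ≤ 1 * a₀ := fun z => by
    rw [hW, norm_smul]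
    refine mul_le_mul ?_ (ha₀ z) (norm_nonneg _) zero_le_one
    rw [Real.norm_of_nonneg (hχ01 z).1]
    exact (hχ01 z).2
  refine ⟨W, memContDiffHolder_succ_iff.2 ⟨by exact_mod_cast hWs, eSupNorm_lt_top_iff.2 ⟨_, hbd⟩,
    hmem⟩, ?_⟩
  filter_upwards [(eventually_nhdsSet_iff_forall.1 hχ1) z₀ (mem_closedBall_self (by positivity)),
    Metric.ball_mem_nhds z₀ hρ] with z hz hz'
  simp [hW, hz, (hball z hz').2.1]

end Assembly

end Literature.Geometry.Symplectic
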